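import Literature.AlgebraicGeometry.Resolution.NeronPopescuSingularIdeal
import Mathlib.RingTheory.Ideal.Over
import Mathlib.RingTheory.Ideal.Quotient.Operations
import HarnessLib

/-!
# Transport of "PT holds for `R → Λ`" along isomorphisms and quotients (frame of Stacks 07F5)

Topic: `Literature/AlgebraicGeometry/Resolution`. Groundwork for the proof of the named fact
`Stacks07F5_reduceToField` (`NeronPopescuSteps.lean`; Stacks, *Smoothing Ring Maps*,
Lemma 07F5: PT for all regular maps of Noetherian rings follows from PT over fields). The
printed proof of 07F5 is a Noetherian induction on the base: "Consider the set of ideals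
`𝓘 = {I ⊂ R ∣ R/I → Λ/IΛ does not have PT}` … Replacing `R` by `R/I` and `Λ` by `Λ/IΛ` we
obtain a situation where PT holds for `R/I → Λ/IΛ` for any nonzero ideal of `R`." Running
this in Lean needs the invariance of PT (in the factorisation form `HasSmoothFactorizations`,
Algebra, Lemma 07C3) under isomorphisms of the pair `(R, Λ)`, and the identifications
`(R/I)/(J/I) ≅ R/J`, `(Λ/IΛ)/(J/I)(Λ/IΛ) ≅ Λ/JΛ`, `R/0 ≅ R`. This file PROVES exactly these
bookkeeping statements (no new notions, no named facts):

* `HasSmoothFactorizations.of_algEquiv` — invariance under an `R`-algebra isomorphism of the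
  target `Λ ≃ₐ[R] Λ'`;
* `HasSmoothFactorizations.of_ringEquiv_base` — invariance under an isomorphism of the base
  `R ≃+* R'` compatible with the two structure maps to the same `Λ`;
* `HasSmoothFactorizations.of_ringEquiv_pair`, `hasSmoothFactorizations_congr` — invariance
  under an isomorphism of pairs `(R, Λ) ≅ (R', Λ')`;
* `hasSmoothFactorizations_of_subsingleton` — PT holds trivially over the zero ring;
* `HasSmoothFactorizations.of_quotient_bot` — PT for `R/0 → Λ/0Λ` gives PT for `R → Λ`;
* `HasSmoothFactorizations.quotQuot` — PT for `R/J → Λ/JΛ` gives PT for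
  `(R/I)/J' → (Λ/IΛ)/J'(Λ/IΛ)` where `J = J' ∩ R ⊇ I` (the form consumed by
  `IsNoetherian.induction` on the ideals of `R`).

## Rendering notes

* `Λ/IΛ` is `Λ ⧸ I.map (algebraMap R Λ)` with Mathlib's `R ⧸ I`-algebra structure
  `Ideal.Quotient.algebraQuotientMapQuotient`.
* Universes: one universe `u`, as in `HasSmoothFactorizations`.

## Sources

* The Stacks Project, *Smoothing Ring Maps* (Tag 07BW): Situation 07F2 and the definition of
  PT, Lemma 07F5 and its proof (the Noetherian induction on `R`); *Algebra*, Lemma 07C3.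
  [StacksProject]
-/

noncomputable section

namespace Literature.AlgebraicGeometry.Resolution

universe u

/-! ## Invariance under isomorphisms -/

section ChangeTarget

variable {R : Type u} [CommRing R] {Λ Λ' : Type u} [CommRing Λ] [Algebra R Λ] [CommRing Λ']
  [Algebra R Λ']

/-- PT for `R → Λ` is invariant under `R`-algebra isomorphisms `Λ ≃ₐ[R] Λ'` of the target:
a factorisation of `A → Λ' ≅ Λ` through a smooth `C` is composed with `Λ ≅ Λ'`. [folklore] -/
theorem HasSmoothFactorizations.of_algEquiv (e : Λ ≃ₐ[R] Λ') (h : HasSmoothFactorizations R Λ) :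
    HasSmoothFactorizations R Λ' := by
  intro A _ _ hA φ'
  obtain ⟨C, _, _, hC, v, w, hvw⟩ := h A hA ((e.symm : Λ' →ₐ[R] Λ).comp φ')
  refine ⟨C, inferInstance, inferInstance, hC, v, (e : Λ →ₐ[R] Λ').comp w, ?_⟩
  rw [AlgHom.comp_assoc, hvw, ← AlgHom.comp_assoc, AlgEquiv.comp_symm, AlgHom.id_comp]

end ChangeTarget

section ChangeBase

variable {R R' Λ : Type u} [CommRing R] [CommRing R'] [CommRing Λ] [Algebra R Λ] [Algebra R' Λ]

/-- PT for `R → Λ` is invariant under isomorphisms of the base: if `e : R ≃+* R'` and the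
`R'`-algebra structure on `Λ` is the `R`-algebra structure transported along `e`, then PT for
`R → Λ` gives PT for `R' → Λ`. (A finite type `R'`-algebra `A'` is a finite type `R`-algebra
through `e`; a smooth `R`-algebra `C` is a smooth `R'`-algebra through `e⁻¹`.) [folklore] -/
theorem HasSmoothFactorizations.of_ringEquiv_base (e : R ≃+* R')
    (he : ∀ r, algebraMap R' Λ (e r) = algebraMap R Λ r) (h : HasSmoothFactorizations R Λ) :
    HasSmoothFactorizations R' Λ := by
  intro A' _ _ hA' φ'
  -- view `A'` and `φ'` over `R` through `e`
  letI : Algebra R R' := e.toRingHom.toAlgebra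
  letI : Algebra R A' := ((algebraMap R' A').comp e.toRingHom).toAlgebra
  haveI : IsScalarTower R R' A' := IsScalarTower.of_algebraMap_eq fun _ => rfl
  haveI : IsScalarTower R R' Λ := IsScalarTower.of_algebraMap_eq fun r => (he r).symm
  have hRR' : Algebra.FiniteType R R' :=
    Algebra.FiniteType.of_surjective (Algebra.ofId R R') e.surjective
  have hA : Algebra.FiniteType R A' := hRR'.trans hA'
  obtain ⟨C, _, _, hC, v, w, hvw⟩ := h A' hA (φ'.restrictScalars R)
  -- make `C` an `R'`-algebra through `e⁻¹`
  letI : Algebra R' C := ((algebraMap R C).comp e.symm.toRingHom).toAlgebra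
  letI : Algebra R' R := e.symm.toRingHom.toAlgebra
  haveI : IsScalarTower R' R C := IsScalarTower.of_algebraMap_eq fun _ => rfl
  let eRR : R' ≃ₐ[R'] R := { e.symm with commutes' := fun _ => rfl }
  haveI : Algebra.Smooth R C := hC
  haveI : Algebra.Smooth R' R := Algebra.Smooth.of_equiv eRR
  have hC' : Algebra.Smooth R' C := Algebra.Smooth.comp R' R C
  have hRA' : ∀ r : R', algebraMap R' A' r = algebraMap R A' (e.symm r) := fun r => by
    change algebraMap R' A' r = algebraMap R' A' (e (e.symm r))
    rw [e.apply_symm_apply]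
  let v' : A' →ₐ[R'] C :=
    { v.toRingHom with
      commutes' := fun r => by
        change v (algebraMap R' A' r) = algebraMap R C (e.symm r)
        rw [hRA', AlgHom.commutes] }
  let w' : C →ₐ[R'] Λ :=
    { w.toRingHom with
      commutes' := fun r => by
        change w (algebraMap R C (e.symm r)) = algebraMap R' Λ r
        rw [AlgHom.commutes, ← he, e.apply_symm_apply] }
  refine ⟨C, inferInstance, inferInstance, hC', v', w', ?_⟩
  ext a
  exact AlgHom.congr_fun hvw a

end ChangeBase

section ChangePair

variable {R R' Λ Λ' : Type u} [CommRing R] [CommRing R'] [CommRing Λ] [CommRing Λ']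
  [Algebra R Λ] [Algebra R' Λ']

/-- **PT is invariant under isomorphisms of pairs**: if `(R → Λ) ≅ (R' → Λ')` through ring
isomorphisms `eR : R ≃ R'`, `eΛ : Λ ≃ Λ'` intertwining the structure maps, then PT for
`R → Λ` gives PT for `R' → Λ'`. [folklore] -/
theorem HasSmoothFactorizations.of_ringEquiv_pair (eR : R ≃+* R') (eΛ : Λ ≃+* Λ')
    (he : ∀ r, eΛ (algebraMap R Λ r) = algebraMap R' Λ' (eR r))
    (h : HasSmoothFactorizations R Λ) : HasSmoothFactorizations R' Λ' := by
  letI : Algebra R Λ' := ((algebraMap R' Λ').comp eR.toRingHom).toAlgebra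
  let eΛ' : Λ ≃ₐ[R] Λ' := { eΛ with commutes' := fun r => he r }
  exact (h.of_algEquiv eΛ').of_ringEquiv_base eR fun _ => rfl

/-- The intertwining relation for the inverse isomorphisms. [folklore] -/
theorem algebraMap_ringEquiv_symm_comm (eR : R ≃+* R') (eΛ : Λ ≃+* Λ')
    (he : ∀ r, eΛ (algebraMap R Λ r) = algebraMap R' Λ' (eR r)) (r' : R') :
    eΛ.symm (algebraMap R' Λ' r') = algebraMap R Λ (eR.symm r') := by
  apply eΛ.injective
  rw [eΛ.apply_symm_apply, he, eR.apply_symm_apply]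

/-- PT for `R → Λ` and for an isomorphic pair `R' → Λ'` are equivalent. [folklore] -/
theorem hasSmoothFactorizations_congr (eR : R ≃+* R') (eΛ : Λ ≃+* Λ')
    (he : ∀ r, eΛ (algebraMap R Λ r) = algebraMap R' Λ' (eR r)) :
    HasSmoothFactorizations R Λ ↔ HasSmoothFactorizations R' Λ' :=
  ⟨fun h => h.of_ringEquiv_pair eR eΛ he, fun h =>
    h.of_ringEquiv_pair eR.symm eΛ.symm (algebraMap_ringEquiv_symm_comm eR eΛ he)⟩

end ChangePair

/-! ## The zero ring -/

section Zero

variable (R Λ : Type u) [CommRing R] [CommRing Λ] [Algebra R Λ]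

/-- PT holds trivially for `R → Λ` when `R = 0` (then `Λ = 0 ≅ R` is itself smooth over `R`,
and every `A → Λ` factors through `Λ`). [folklore] -/
theorem hasSmoothFactorizations_of_subsingleton [Subsingleton R] : HasSmoothFactorizations R Λ := by
  intro A _ _ _ φ
  haveI : Subsingleton Λ := (algebraMap R Λ).codomain_trivial
  have hbij : Function.Bijective (Algebra.ofId R Λ) :=
    ⟨fun _ _ _ => Subsingleton.elim _ _, fun y => ⟨0, Subsingleton.elim _ _⟩⟩
  haveI : Algebra.Smooth R R := ⟨inferInstance, inferInstance⟩
  haveI : Algebra.Smooth R Λ := Algebra.Smooth.of_equiv (AlgEquiv.ofBijective _ hbij)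
  exact ⟨Λ, inferInstance, inferInstance, inferInstance, φ, AlgHom.id R Λ, AlgHom.id_comp φ⟩

end Zero

/-! ## Quotients of the base: `R/0` and `(R/I)/(J/I)` -/

section Quotients

variable {R Λ : Type u} [CommRing R] [CommRing Λ] [Algebra R Λ]

/-- PT for `R/0 → Λ/0Λ` is PT for `R → Λ` (`R/0 ≅ R`, `Λ/0Λ ≅ Λ` compatibly). [folklore] -/
theorem HasSmoothFactorizations.of_quotient_bot
    (h : HasSmoothFactorizations (R ⧸ (⊥ : Ideal R))
      (Λ ⧸ (⊥ : Ideal R).map (algebraMap R Λ))) :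
    HasSmoothFactorizations R Λ := by
  have hbot : (⊥ : Ideal R).map (algebraMap R Λ) = ⊥ := Ideal.map_bot
  let eR : (R ⧸ (⊥ : Ideal R)) ≃+* R := RingEquiv.quotientBot R
  let eΛ : (Λ ⧸ (⊥ : Ideal R).map (algebraMap R Λ)) ≃+* Λ :=
    (Ideal.quotEquivOfEq hbot).trans (RingEquiv.quotientBot Λ)
  refine h.of_ringEquiv_pair eR eΛ fun x => ?_
  obtain ⟨r, rfl⟩ := Ideal.Quotient.mk_surjective x
  rw [Ideal.Quotient.algebraMap_quotient_map_quotient]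
  rfl

/-- The extension of `J' ⊂ R/I` to `Λ/IΛ` is the image of `JΛ` for `J = J' ∩ R`:
`J'(Λ/IΛ) = (JΛ + IΛ)/IΛ`. [folklore] -/
theorem map_algebraMap_quotient_eq (I : Ideal R) (J' : Ideal (R ⧸ I)) :
    J'.map (algebraMap (R ⧸ I) (Λ ⧸ I.map (algebraMap R Λ))) =
      ((J'.comap (Ideal.Quotient.mk I)).map (algebraMap R Λ)).map
        (Ideal.Quotient.mk (I.map (algebraMap R Λ))) := by
  conv_lhs => rw [← Ideal.map_comap_of_surjective (Ideal.Quotient.mk I)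
    Ideal.Quotient.mk_surjective J']
  rw [Ideal.map_map, Ideal.map_map]
  congr 1

/-- **PT passes to the double quotient**: for ideals `I ⊆ R` and `J' ⊆ R/I` with
`J = J' ∩ R` (so `I ⊆ J` and `(R/I)/J' ≅ R/J`, `(Λ/IΛ)/J'(Λ/IΛ) ≅ Λ/JΛ` compatibly), PT for
`R/J → Λ/JΛ` gives PT for `(R/I)/J' → (Λ/IΛ)/J'(Λ/IΛ)`. This is the rewriting step
"replacing `R` by `R/I` and `Λ` by `Λ/IΛ`" of the proof of Stacks 07F5.
[cite: StacksProject, Tag 07F5 (proof)] -/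
theorem HasSmoothFactorizations.quotQuot (I : Ideal R) (J' : Ideal (R ⧸ I))
    (h : HasSmoothFactorizations (R ⧸ J'.comap (Ideal.Quotient.mk I))
      (Λ ⧸ (J'.comap (Ideal.Quotient.mk I)).map (algebraMap R Λ))) :
    HasSmoothFactorizations ((R ⧸ I) ⧸ J')
      ((Λ ⧸ I.map (algebraMap R Λ)) ⧸
        J'.map (algebraMap (R ⧸ I) (Λ ⧸ I.map (algebraMap R Λ)))) := by
  set J : Ideal R := J'.comap (Ideal.Quotient.mk I) with hJdef
  set IΛ : Ideal Λ := I.map (algebraMap R Λ) with hIΛ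
  set JΛ : Ideal Λ := J.map (algebraMap R Λ) with hJΛ
  have hIJ : I ≤ J := fun x hx => by
    rw [hJdef, Ideal.mem_comap, Ideal.Quotient.eq_zero_iff_mem.mpr hx]
    exact J'.zero_mem
  have hIJΛ : IΛ ≤ JΛ := Ideal.map_mono hIJ
  have hJ' : J' = J.map (Ideal.Quotient.mk I) :=
    (Ideal.map_comap_of_surjective _ Ideal.Quotient.mk_surjective J').symm
  have hJ'Λ : J'.map (algebraMap (R ⧸ I) (Λ ⧸ IΛ)) = JΛ.map (Ideal.Quotient.mk IΛ) :=
    map_algebraMap_quotient_eq I J'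
  -- the two ring isomorphisms
  let eR : (R ⧸ J) ≃+* ((R ⧸ I) ⧸ J') :=
    ((Ideal.quotEquivOfEq hJ').trans (DoubleQuot.quotQuotEquivQuotOfLE hIJ)).symm
  let eΛ : (Λ ⧸ JΛ) ≃+* ((Λ ⧸ IΛ) ⧸ J'.map (algebraMap (R ⧸ I) (Λ ⧸ IΛ))) :=
    ((Ideal.quotEquivOfEq hJ'Λ).trans (DoubleQuot.quotQuotEquivQuotOfLE hIJΛ)).symm
  refine h.of_ringEquiv_pair eR eΛ fun x => ?_
  obtain ⟨r, rfl⟩ := Ideal.Quotient.mk_surjective x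
  rw [Ideal.Quotient.algebraMap_quotient_map_quotient]
  change ((Ideal.quotEquivOfEq hJ'Λ).symm ((DoubleQuot.quotQuotEquivQuotOfLE hIJΛ).symm
      (Ideal.Quotient.mk JΛ (algebraMap R Λ r)))) =
    algebraMap _ _ ((Ideal.quotEquivOfEq hJ').symm ((DoubleQuot.quotQuotEquivQuotOfLE hIJ).symm
      (Ideal.Quotient.mk J r)))
  rw [DoubleQuot.quotQuotEquivQuotOfLE_symm_mk, DoubleQuot.quotQuotEquivQuotOfLE_symm_mk,
    Ideal.quotEquivOfEq_symm, Ideal.quotEquivOfEq_symm, DoubleQuot.quotQuotMk,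
    DoubleQuot.quotQuotMk, RingHom.comp_apply, RingHom.comp_apply, Ideal.quotEquivOfEq_mk,
    Ideal.quotEquivOfEq_mk, Ideal.Quotient.algebraMap_quotient_map_quotient,
    Ideal.Quotient.algebraMap_quotient_map_quotient]

end Quotients

end Literature.AlgebraicGeometry.Resolution

end
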